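import Literature.MathematicalPhysics.QuantumFieldTheory.Balaban1983to89.Beta.HessKerSchurL2
import Literature.MathematicalPhysics.QuantumFieldTheory.Balaban1983to89.Beta.RemainderConstNumerals

/-!
# `Balaban1983to89.Beta.LatticeConstantZl` — the lattice Gaussian sum `Zl D c = Σ_{x∈ℤ^D} e^{−c|x|₁}` of road A2 in CLOSED
# FORM (`= coth(c/2)^D`), its monotonicity and two-sided elementary sandwich, the fibre count `|Fib d| = 2(d+1)`, and the
# weighted-`ℓ²` bridge constant `zL2 d κ R = √(|Fib d|·Zl_{d+1}(2(κ−R)))` of `Beta.HessKerSchurL2` EXACTLY — at `d = 3`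
# (`D = 4`, the cell's case) with NO square root of a series left: `zL2 3 κ R = 2√2·coth(κ−R)²`
# (cell `pub-balaban`, β sub-cell, β-PERT ACCELERATION asymptotic lane asym2 = unit `b2b-balaban-beta-asym2`, gen 17, v1;
# companion of `Beta.RemainderConstNumerals` §2/§6 and of the lane memo `HOME/BETA/ASYM2.md` §17).

HONEST FRAMING (cell contract, verbatim, page 1 of everything): «discharging `BetaPertH` makes Bałaban's UV stability
UNCONDITIONAL — a real constructive-QFT result; it is NOT the continuum limit and NOT the Clay problem.»  THIS MODULE is
[folklore] arithmetic on `ℤ^D` (a geometric series per coordinate, Cauchy–Schwarz bookkeeping constants); it formalises NO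
statement printed in Bałaban's papers, cites none as a hypothesis, mints no `Prop` fact, instantiates NO binder of the wall
`BetaPertWall` (RULING (R18-3)) and DISCHARGES NOTHING of it.  NOT summit progress.

ABSOLUTE RULE (cell, verbatim): «No internally-minted statement may enter as a cited fact. Every hypothesis is either
kernel-proved in this package or a verbatim quotation of a PUBLISHED theorem with page reference. The manuscript(s) under
audit are NOT citable for their own disputed steps — they are the thing under adjudication; programme-internal
(2001/route/tribunal) claims are never citable.»  Every theorem below is kernel-proved real-number algebra over the tree's
DEFINITIONS `ExpKernelCalculus.Zl`, `B12Decay510Window.K₁`, `RemainderConstNumerals.mom₀`, `OneStepResolventKernel.Fib`,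
`HessKerSchurL2.zL2`; there are no hypotheses other than `0 < c` / `R < κ`.

SOURCE CONTEXT (attribution of where the constant arises, NOT a hypothesis of anything here): the cube-sum constant
`K₁(a) = Σ_{z∈ℤ^d} e^{−a|z|₁}` is the constant of leaf (c) of T. Bałaban, *Renormalization group approach to lattice gauge
field theories. I*, Commun. Math. Phys. **109** (1987) 249–301 [Balaban1987RG1] = B12, (5.10) p. 293 (typed
`B12Decay510Window.cubeSumLeaf`, closed form `RemainderConstNumerals.K₁_eq_pow`); `ExpKernelCalculus.Zl` is the SAME series
under the name used by the `Beta.*` kernel calculus (`Zl_eq_K₁` below, `rfl`).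

WHY THIS LEAF (budget bookkeeping only; located open piece O-asym1-6 of `HOME/BETA/ASYM-beta.md` §3.6 (vi)).  Road A2's one
numeric condition has `c₀ = lipW(…)·S_D(R·N)`, and the lattice sum `Zl` multiplies EVERY resolvent / stencil / vertex constant
that enters `lipW`: `|Fib d|·C·Zl_{d+1}(δ_K − R)` per resolvent and `|Fib d|²·C·Zl_{d+1}(δ − R)²` per stencil / vertex in the
pointwise chain (`HessKerSchur.colW_of_decays`, its END corollary), `zL2 d κ R·B` per resolvent in the weighted-`ℓ²` chain
(`HessKerSchurL2.colW_of_colL2`, its END corollary), `|Fib d|·C_K C_V·Zl_{d+1}(δ_V)` in `InterLevelTransport`.  Before this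
leaf the tree knew `Zl_pos`, `Zl_nonneg` and the shift identities `tsum_exp_shift(')` — no value.  After it, `Zl D c = mom₀ c ^ D`
with `mom₀ c = (1 + e^{−c})/(1 − e^{−c}) = coth(c/2)` (`RemainderConstNumerals` §6), so every such constant is an explicit
rational function of `e^{−c}`; e.g. the `D = 4` values `Zl₄(c) = coth(c/2)⁴` (`c = 1/8: ≈ 6.6·10⁴ ∣ 1/4: ≈ 4.2·10³ ∣ 1/2: ≈ 2.8·10² ∣
1: ≈ 21.9 ∣ 3/2: ≈ 6.1 ∣ 2: ≈ 3.0 ∣ 3: ≈ 1.5`, asym1's illustration table) are now instances of a kernel identity (the decimals are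
generating-function arithmetic outside Lean and are NOT asserted here).  The two-sided ELEMENTARY sandwich
`(2/c − 1)^D ≤ Zl D c ≤ (1 + 2/c)^D` (`0 < c ≤ 2` for the lower half) records the true order `Zl D c ≍ (2/c)^D` as the gap
`c ↓ 0` with no exponential left.

CONTENT.  §1 `Zl = K₁` (`rfl`), `Zl D c = mom₀ c ^ D = ((1 + e^{−c})/(1 − e^{−c}))^D` (`0 < c`), `Zl 0 c = 1`, `Zl 1 c = mom₀ c`,
the product step, `1 ≤ Zl`, `1 < Zl` (`D ≠ 0`).  §2 monotonicity: `Zl D ·` and `mom₀` are antitone on `(0, ∞)`; the sandwich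
`2/c − 1 ≤ mom₀ c ≤ 1 + 2/c`, `(2/c − 1)^D ≤ Zl D c ≤ (1 + 2/c)^D`.  §3 `|Fib d| = 2(d+1)`; `zL2 d κ R = √(2(d+1)·mom₀(2(κ−R))^{d+1})`
(`R < κ`), its square, the even-exponent form `d + 1 = 2n ⟹ zL2 = √(2(d+1))·mom₀(2(κ−R))^n`, the cell's case
`zL2 3 κ R = 2√2·mom₀(2(κ−R))²` and its elementary majorant `≤ 2√2·(1 + 1/(κ−R))²`.  §4 comparison of the two conversion
constants: `zL2 d κ R ≤ |Fib d|·Zl_{d+1}(κ−R)` — the weighted-`ℓ²` bridge never costs more than the pointwise conversion at the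
same rate loss (it is usually far cheaper: `D = 5`, `κ − R = 1/2`: `√(10·coth(1/2)⁵) ≈ 21.8` against `10·coth(1/4)⁵ ≈ 1.13·10⁴`,
`HessKerSchurL2` header; decimals not asserted).

RELATION TO THE TREE (no duplication): `RemainderConstNumerals` §2/§6 proves the closed form for `K₁` and defines `mom₀`; this
leaf only TRANSPORTS it to the name `Zl` used by `ExpKernelCalculus` / `HessKerSchur` / `HessKerSchurL2` / `InterLevelTransport`
and evaluates `zL2`.  It is imported by nobody (a leaf), so no consumer's import closure changes.

WHAT IS NOT HERE (located, NOT claimed): any value of `κ, R, δ` or of the bounds `B, C` for Bałaban's kernels (supplier data,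
(α)/(CONV-C), OPEN, not in print); any decimal.  NOT continuum, NOT Clay.
-/

open Literature.MathematicalPhysics.QuantumFieldTheory.Balaban1983to89
open Literature.MathematicalPhysics.QuantumFieldTheory.Balaban1983to89.Beta
open B12Sec2to5 (l1 l1_nonneg summable_exp_neg_l1)
open B12Decay510Window (K₁ K₁_nonneg)
open ExpKernelCalculus (Zl Zl_pos Zl_nonneg)
open RemainderConstNumerals (mom₀ K₁_zero K₁_eq_mom₀_pow K₁_eq_pow K₁_le_pow one_lt_mom₀ ratio_le_one_add)
open OneStepResolventKernel (Fib)
open HessKerSchurL2 (zL2 zL2_nonneg)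

namespace Literature.MathematicalPhysics.QuantumFieldTheory.Balaban1983to89.Beta.LatticeConstantZl

noncomputable section

/-! ## §1 `Zl = K₁` and the closed form `Zl D c = coth(c/2)^D` -/

variable {D : ℕ} {c : ℝ}

/-- `ExpKernelCalculus.Zl D c` and `B12Decay510Window.K₁ D c` are the SAME series `Σ_{x : Fin D → ℤ} e^{−c|x|₁}`. [folklore] -/
theorem Zl_eq_K₁ (D : ℕ) (c : ℝ) : Zl D c = K₁ D c := rfl

/-- **`Zl D c = mom₀ c ^ D`** for `0 < c` (`mom₀ c = (1 + e^{−c})/(1 − e^{−c}) = coth(c/2)`; `RemainderConstNumerals.K₁_eq_mom₀_pow`).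
[folklore] -/
theorem Zl_eq_mom₀_pow (hc : 0 < c) (D : ℕ) : Zl D c = mom₀ c ^ D := by
  rw [Zl_eq_K₁]
  exact K₁_eq_mom₀_pow hc D

/-- `Zl D c = ((1 + e^{−c})/(1 − e^{−c}))^D` for `0 < c`. [folklore] -/
theorem Zl_eq_explicit (hc : 0 < c) (D : ℕ) : Zl D c = ((1 + Real.exp (-c)) / (1 - Real.exp (-c))) ^ D := by
  rw [Zl_eq_K₁]
  exact K₁_eq_pow hc D

/-- `Zl 0 c = 1` (one point). [folklore] -/
theorem Zl_zero_dim (c : ℝ) : Zl 0 c = 1 := by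
  rw [Zl_eq_K₁]
  exact K₁_zero c

/-- `Zl 1 c = mom₀ c` for `0 < c` (the one-dimensional sum). [folklore] -/
theorem Zl_one_dim (hc : 0 < c) : Zl 1 c = mom₀ c := by
  rw [Zl_eq_mom₀_pow hc, pow_one]

/-- Product step `Zl (D+1) c = mom₀ c · Zl D c` for `0 < c`. [folklore] -/
theorem Zl_succ_dim (hc : 0 < c) (D : ℕ) : Zl (D + 1) c = mom₀ c * Zl D c := by
  rw [Zl_eq_mom₀_pow hc, Zl_eq_mom₀_pow hc, pow_succ, mul_comm]

/-- `0 < mom₀ c` for `0 < c`. [folklore] -/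
theorem mom₀_pos (hc : 0 < c) : 0 < mom₀ c := zero_lt_one.trans (one_lt_mom₀ hc)

/-- `1 ≤ Zl D c` for `0 < c`. [folklore] -/
theorem one_le_Zl (hc : 0 < c) (D : ℕ) : 1 ≤ Zl D c := by
  rw [Zl_eq_mom₀_pow hc]
  exact one_le_pow₀ (one_lt_mom₀ hc).le

/-- `1 < Zl D c` for `0 < c` and `D ≠ 0`. [folklore] -/
theorem one_lt_Zl (hc : 0 < c) (hD : D ≠ 0) : 1 < Zl D c := by
  rw [Zl_eq_mom₀_pow hc]
  exact one_lt_pow₀ (one_lt_mom₀ hc) hD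

/-! ## §2 Monotonicity in the rate and the elementary sandwich `(2/c − 1)^D ≤ Zl D c ≤ (1 + 2/c)^D` -/

/-- `Zl D ·` is ANTITONE on `(0, ∞)`: `0 < c ≤ c'` ⟹ `Zl D c' ≤ Zl D c` (termwise `e^{−c'|x|₁} ≤ e^{−c|x|₁}`). [folklore] -/
theorem Zl_anti (hc : 0 < c) {c' : ℝ} (hcc' : c ≤ c') : Zl D c' ≤ Zl D c := by
  have hc' : 0 < c' := hc.trans_le hcc'
  unfold Zl
  refine (summable_exp_neg_l1 hc' D).tsum_le_tsum (fun x => ?_) (summable_exp_neg_l1 hc D)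
  exact Real.exp_le_exp.mpr (by nlinarith [l1_nonneg x])

/-- `mom₀` is ANTITONE on `(0, ∞)`: `0 < c ≤ c'` ⟹ `mom₀ c' ≤ mom₀ c`. [folklore] -/
theorem mom₀_anti (hc : 0 < c) {c' : ℝ} (hcc' : c ≤ c') : mom₀ c' ≤ mom₀ c := by
  rw [← Zl_one_dim hc, ← Zl_one_dim (hc.trans_le hcc')]
  exact Zl_anti hc hcc'

/-- Upper half of the sandwich in one dimension: `mom₀ c ≤ 1 + 2/c` for `0 < c` (`RemainderConstNumerals.ratio_le_one_add`,
i.e. `1 + c ≤ e^c`). [folklore] -/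
theorem mom₀_le_elem (hc : 0 < c) : mom₀ c ≤ 1 + 2 / c := ratio_le_one_add hc

/-- Lower half of the sandwich in one dimension: `2/c − 1 ≤ mom₀ c` for `0 < c` (from `1 − c ≤ e^{−c}`: the denominator
`1 − e^{−c} ≤ c`, the numerator `1 + e^{−c} ≥ 2 − c`). [folklore] -/
theorem elem_le_mom₀ (hc : 0 < c) : 2 / c - 1 ≤ mom₀ c := by
  have hq0 : 0 < Real.exp (-c) := Real.exp_pos _
  have hq1 : Real.exp (-c) < 1 := Real.exp_lt_one_iff.mpr (by linarith)
  have hq2 : 1 - c ≤ Real.exp (-c) := Real.one_sub_le_exp_neg c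
  have h1q : 0 < 1 - Real.exp (-c) := by linarith
  unfold mom₀
  rw [le_div_iff₀ h1q]
  have h2 : 2 / c * (1 - Real.exp (-c)) ≤ 2 / c * c := mul_le_mul_of_nonneg_left (by linarith) (by positivity)
  have h3 : 2 / c * c = 2 := div_mul_cancel₀ 2 hc.ne'
  nlinarith

/-- `Zl D c ≤ (1 + 2/c)^D` for `0 < c` — no exponential left (`RemainderConstNumerals.K₁_le_pow`). [folklore] -/
theorem Zl_le_elem (hc : 0 < c) (D : ℕ) : Zl D c ≤ (1 + 2 / c) ^ D := by
  rw [Zl_eq_K₁]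
  exact K₁_le_pow hc D

/-- `(2/c − 1)^D ≤ Zl D c` for `0 < c ≤ 2` — together with `Zl_le_elem`: `Zl D c ≍ (2/c)^D` as `c ↓ 0`. [folklore] -/
theorem elem_le_Zl (hc : 0 < c) (hc2 : c ≤ 2) (D : ℕ) : (2 / c - 1) ^ D ≤ Zl D c := by
  rw [Zl_eq_mom₀_pow hc]
  have h0 : 0 ≤ 2 / c - 1 := by
    rw [sub_nonneg, le_div_iff₀ hc]
    linarith
  exact pow_le_pow_left₀ h0 (elem_le_mom₀ hc) D

/-! ## §3 The fibre count and the weighted-`ℓ²` bridge constant `zL2` in closed form -/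

variable {d : ℕ} {κ R : ℝ}

/-- `|Fib d| = |Fin (d+1) ⊕ Fin (d+1)| = 2(d+1)`. [folklore] -/
theorem card_Fib (d : ℕ) : Fintype.card (Fib d) = 2 * (d + 1) := by
  simp only [Fib, Fintype.card_sum, Fintype.card_fin]
  ring

/-- `(|Fib d| : ℝ) = 2(d+1)`. [folklore] -/
theorem card_Fib_real (d : ℕ) : (Fintype.card (Fib d) : ℝ) = 2 * ((d : ℝ) + 1) := by
  rw [card_Fib]
  push_cast
  ring

/-- **`zL2 d κ R = √(2(d+1)·mom₀(2(κ−R))^{d+1})`** for `R < κ`. [folklore] -/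
theorem zL2_eq_sqrt (hκ : R < κ) (d : ℕ) :
    zL2 d κ R = Real.sqrt (2 * ((d : ℝ) + 1) * mom₀ (2 * (κ - R)) ^ (d + 1)) := by
  have h2 : 0 < 2 * (κ - R) := by linarith
  show Real.sqrt ((Fintype.card (Fib d) : ℝ) * Zl (d + 1) (2 * (κ - R))) = _
  rw [card_Fib_real, Zl_eq_mom₀_pow h2]

/-- The radicand is nonnegative. [folklore] -/
theorem zL2_radicand_nonneg (hκ : R < κ) (d : ℕ) : 0 ≤ 2 * ((d : ℝ) + 1) * mom₀ (2 * (κ - R)) ^ (d + 1) := by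
  have := (mom₀_pos (show 0 < 2 * (κ - R) by linarith)).le
  positivity

/-- `zL2 d κ R ^ 2 = 2(d+1)·mom₀(2(κ−R))^{d+1}` for `R < κ`. [folklore] -/
theorem zL2_sq (hκ : R < κ) (d : ℕ) : zL2 d κ R ^ 2 = 2 * ((d : ℝ) + 1) * mom₀ (2 * (κ - R)) ^ (d + 1) := by
  rw [zL2_eq_sqrt hκ, Real.sq_sqrt (zL2_radicand_nonneg hκ d)]

/-- EVEN exponent: `d + 1 = 2n` ⟹ `zL2 d κ R = √(2(d+1)) · mom₀(2(κ−R))^n` — only the square root of an integer is left.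
[folklore] -/
theorem zL2_eq_of_even (hκ : R < κ) {n : ℕ} (hn : d + 1 = 2 * n) :
    zL2 d κ R = Real.sqrt (2 * ((d : ℝ) + 1)) * mom₀ (2 * (κ - R)) ^ n := by
  have hm : 0 ≤ mom₀ (2 * (κ - R)) := (mom₀_pos (show 0 < 2 * (κ - R) by linarith)).le
  rw [zL2_eq_sqrt hκ, hn, Real.sqrt_mul (by positivity), pow_mul', Real.sqrt_sq (pow_nonneg hm n)]

/-- **THE CELL'S CASE `d = 3` (`D = 4`, `|Fib 3| = 8`)**: `zL2 3 κ R = 2√2 · mom₀(2(κ−R))² = 2√2·coth(κ−R)²` for `R < κ` —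
NO square root of a series left (`√8 = 2√2`). [folklore] -/
theorem zL2_three_eq (hκ : R < κ) : zL2 3 κ R = 2 * Real.sqrt 2 * mom₀ (2 * (κ - R)) ^ 2 := by
  have h8 : Real.sqrt 8 = 2 * Real.sqrt 2 := by
    rw [show (8 : ℝ) = 2 ^ 2 * 2 by norm_num, Real.sqrt_mul (by positivity), Real.sqrt_sq (by norm_num)]
  rw [zL2_eq_of_even hκ (show 3 + 1 = 2 * 2 by norm_num), ← h8]
  norm_num

/-- … and its elementary majorant `zL2 3 κ R ≤ 2√2 · (1 + 1/(κ−R))²` (`mom₀(2s) ≤ 1 + 1/s`). [folklore] -/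
theorem zL2_three_le_elem (hκ : R < κ) : zL2 3 κ R ≤ 2 * Real.sqrt 2 * (1 + 1 / (κ - R)) ^ 2 := by
  have hs : 0 < κ - R := by linarith
  have hm0 : 0 ≤ mom₀ (2 * (κ - R)) := (mom₀_pos (show 0 < 2 * (κ - R) by linarith)).le
  have hm : mom₀ (2 * (κ - R)) ≤ 1 + 1 / (κ - R) := by
    have h := mom₀_le_elem (show 0 < 2 * (κ - R) by linarith)
    rwa [show (2 : ℝ) / (2 * (κ - R)) = 1 / (κ - R) by field_simp] at h
  rw [zL2_three_eq hκ]
  exact mul_le_mul_of_nonneg_left (pow_le_pow_left₀ hm0 hm 2) (by positivity)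

/-- … and its elementary minorant `2√2 · (1/(κ−R) − 1)² ≤ zL2 3 κ R` for `0 < κ − R ≤ 1` (`1/s − 1 ≤ mom₀(2s)`). [folklore] -/
theorem elem_le_zL2_three (hκ : R < κ) (h1 : κ - R ≤ 1) : 2 * Real.sqrt 2 * (1 / (κ - R) - 1) ^ 2 ≤ zL2 3 κ R := by
  have hs : 0 < κ - R := by linarith
  have h0 : 0 ≤ 1 / (κ - R) - 1 := by
    rw [sub_nonneg, le_div_iff₀ hs]
    linarith
  have hm : 1 / (κ - R) - 1 ≤ mom₀ (2 * (κ - R)) := by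
    have h := elem_le_mom₀ (show 0 < 2 * (κ - R) by linarith)
    rwa [show (2 : ℝ) / (2 * (κ - R)) = 1 / (κ - R) by field_simp] at h
  rw [zL2_three_eq hκ]
  exact mul_le_mul_of_nonneg_left (pow_le_pow_left₀ h0 hm 2) (by positivity)

/-! ## §4 The weighted-`ℓ²` bridge constant against the pointwise-conversion constant -/

/-- **`zL2 d κ R ≤ |Fib d| · Zl_{d+1}(κ − R)`** for `R < κ`: the constant of `HessKerSchurL2.colW_of_colL2` never exceeds the
constant `|F|·Zl_D(δ−R)` of `HessKerSchur.colW_of_decays` at the same rate loss (`Zl(2s) ≤ Zl(s)`, `1 ≤ |Fib d|`, `1 ≤ Zl`).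
[folklore] -/
theorem zL2_le_card_mul_Zl (hκ : R < κ) (d : ℕ) : zL2 d κ R ≤ (Fintype.card (Fib d) : ℝ) * Zl (d + 1) (κ - R) := by
  have hs : 0 < κ - R := by linarith
  have hF : (1 : ℝ) ≤ Fintype.card (Fib d) := by
    rw [card_Fib_real]
    have := (Nat.cast_nonneg d : (0 : ℝ) ≤ d)
    linarith
  have hZ1 : 1 ≤ Zl (d + 1) (κ - R) := one_le_Zl hs _
  have hZ2 : Zl (d + 1) (2 * (κ - R)) ≤ Zl (d + 1) (κ - R) := Zl_anti hs (by linarith)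
  have hFZ0 : 0 ≤ (Fintype.card (Fib d) : ℝ) * Zl (d + 1) (κ - R) := by positivity
  have hFZ1 : 1 ≤ (Fintype.card (Fib d) : ℝ) * Zl (d + 1) (κ - R) := one_le_mul_of_one_le_of_one_le hF hZ1
  show Real.sqrt _ ≤ _
  rw [Real.sqrt_le_left hFZ0]
  calc (Fintype.card (Fib d) : ℝ) * Zl (d + 1) (2 * (κ - R))
      ≤ (Fintype.card (Fib d) : ℝ) * Zl (d + 1) (κ - R) := mul_le_mul_of_nonneg_left hZ2 (by positivity)
    _ ≤ (Fintype.card (Fib d) : ℝ) * Zl (d + 1) (κ - R) * ((Fintype.card (Fib d) : ℝ) * Zl (d + 1) (κ - R)) :=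
        le_mul_of_one_le_right hFZ0 hFZ1
    _ = ((Fintype.card (Fib d) : ℝ) * Zl (d + 1) (κ - R)) ^ 2 := by ring

/-- The pointwise-conversion constant of the cell's case in closed form: `|Fib 3|·Zl₄(s) = 8·mom₀(s)⁴` (`0 < s`). [folklore] -/
theorem card_Fib_mul_Zl_three_eq {s : ℝ} (hs : 0 < s) : (Fintype.card (Fib 3) : ℝ) * Zl (3 + 1) s = 8 * mom₀ s ^ 4 := by
  rw [card_Fib_real, Zl_eq_mom₀_pow hs]
  norm_num

end

end Literature.MathematicalPhysics.QuantumFieldTheory.Balaban1983to89.Beta.LatticeConstantZl
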